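import Summits.AnomalousDissipation.AnomalousDissipation.Theorems.MomentParityMomentLadderRealTime
import Summits.AnomalousDissipation.AnomalousDissipation.Theorems.MomentParityMomentLadderStubClosureAllDegrees
import Summits.AnomalousDissipation.AnomalousDissipation.Theorems.MomentParityMomentLadderOneTrajectory
import Summits.AnomalousDissipation.AnomalousDissipation.Theorems.MomentLadder.Negative.EnergyRow

/-!
# Crux `MomentParity.MomentLadder` (stmt-AnomalousDissipation-11463), line `Sketch`: the one-trajectory resolved Taylor
# currency is EXACT — `MomentLadder → T_res`, hence `T_res ↔ MomentLadder` (converse machinery 4/4)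

`MomentLadder_of_oneTrajectoryResolved` (landed, `…OneTrajectory.lean`) proves T_res ⟹ crux, where T_res := per `(j, N)`
ONE mean-zero Galerkin datum whose orbit has cumulative Taylor ratio `≥ κ` (the open stub `stub_oneTrajectoryTaylor` of
the sibling crux `GalerkinInvariantLoud`, verbatim) AND `N`-uniformly resolved time-averaged enstrophy tails. Here the
converse: from a witness family of `MomentLadder` — closed over the moment order (`stub_closureAllDegrees`), pushed to the
phase space (`…PhaseLaw`), read through one-step time means (`…TimeMeans`) and Birkhoff's theorem with the UI budget of the
resolution clause (`…Selection.exists_good_datum`) — ONE good datum per `(j, N)` is selected, with thresholds chosen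
from `(ν_j, ε, R_j, κ_j)` BEFORE the level `N` (`goodDatum_thresholds_exist`), and its orbit statistics are converted to
the crux's one-trajectory clauses (§A: integer-time limits ⟹ real-time `liminf`/`limsup`; §B: orbit identities).

* `oneTrajectoryResolved_of_MomentLadder` — **MomentLadder ⟹ T_res**;
* `oneTrajectoryResolved_iff_MomentLadder` — **T_res ⟺ MomentLadder**: the crux IS "one converged DNS run per `(ν_j, N)`";
* `oneTrajectoryTaylor_of_MomentLadder` — the crux implies the sibling crux's open one-trajectory stub verbatim;
* `oneTrajectoryTaylor_of_galerkinInvariantLoud` — **GalerkinInvariantLoud ⟹ `stub_oneTrajectoryTaylor`** (no schedule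
  needed: a level-`N` law is trivially resolved by `κ ≡ N`), closing the sibling line's currency loop (`OTT ↔ GIL` together
  with its landed S1–S3).

Folklore (Birkhoff 1931; Krylov–Bogoliubov 1937; Foias–Manley–Rosa–Temam 2001, Ch. IV).
-/

set_option linter.dupNamespace false

noncomputable section

namespace Summit.AnomalousDissipation.AnomalousDissipation.Theorems.MomentLadder

open MeasureTheory Filter Topology Set Function UnitAddTorus intervalIntegral
open scoped ENNReal
open Literature.Analysis.FunctionSpaces Literature.Analysis.FluidPDE
open Summit.AnomalousDissipation.AnomalousDissipation.Theses.MomentParity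
open Summit.AnomalousDissipation.AnomalousDissipation.Theorems.QuarticGate.Negative
open Summit.AnomalousDissipation.AnomalousDissipation.Theorems.CubicParityLoud.Negative (T3 R3 H3 L2T3)
open Summit.AnomalousDissipation.AnomalousDissipation.Theorems.MomentLadder.Negative
  (IsSupported IsResolved IsLadderWitness momentLadder_iff)

/-! ## §C Assembly: `MomentLadder → T_res`, the equivalence, and the corner for `GalerkinInvariantLoud` -/

section Assembly

/-- **Reading a good datum in the currency of the crux.** For an admissible law `μ` at `(ν, f, N, R)` which is `κ`-resolved
with energy `≤ E₀` (`0 < E₀`) and dissipation `≥ ε > 0`, and level-free thresholds `n₀`, `L`, the Galerkin orbit of the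
selected datum has cumulative Taylor ratio `≥ ε/(2E₀)` and time-averaged unresolved enstrophy beyond
`κ((n+1)2^(n+1)L)` with `limsup ≤ 1/(n+1)` for every `n`. [folklore] -/
theorem exists_datum_oneTrajectory {ν : ℝ} {f : T3 → R3} {N : ℕ} {R : ℝ} {μ : Measure H3} [IsProbabilityMeasure μ]
    (hν : 0 < ν) (hf : Torus.IsSmooth f) (hf0 : Torus.HasZeroMean f)
    (hL : ∀ᵐ u ∂μ, IsLevel N u) (hB : ∀ᵐ u ∂μ, ‖u‖ ≤ R) (hS : ∀ d : ℕ, IsPolyStationary ν f N d μ)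
    {κ : ℕ → ℕ} (hres : IsResolved κ μ) {E₀ ε : ℝ} (hE₀ : 0 < E₀) (hε : 0 < ε)
    (hE : Torus.ensembleEnergy μ ≤ E₀) (hD : ε ≤ Torus.ensembleDissipation ν μ)
    {L n₀ : ℕ} (hL1 : 1 ≤ L)
    (hthr : ν * (8 * Real.pi ^ 2 * ((κ n₀ : ℕ) : ℝ) ^ 2 * R ^ 2 / L + 2 * ((n₀ : ℝ) + 1)⁻¹) < ε / 2) :
    ∃ a : T3 → R3, IsGalerkinMode N a ∧ Torus.HasZeroMean a ∧
      ε / (2 * E₀) ≤ Filter.liminf (fun T : ℝ =>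
        (ν * (∫⁻ t in Ioo 0 T, Torus.eGradNormSq (Torus.galerkinFlow ν f N t a)).toReal) /
          (∫ t in (0 : ℝ)..T, ∫ y, ‖Torus.galerkinFlow ν f N t a y‖ ^ 2)) atTop ∧
      ∀ n : ℕ, Filter.limsup (fun T : ℝ => (ENNReal.ofReal T)⁻¹ *
        ∫⁻ t in Ioo 0 T, (Torus.eGradNormSq (Torus.galerkinFlow ν f N t a) -
          Torus.eGradNormSq (Torus.fourierTruncate (κ ((n + 1) * 2 ^ (n + 1) * L)) (Torus.galerkinFlow ν f N t a)))) atTop ≤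
        ((n : ℝ≥0∞) + 1)⁻¹ := by
  have hg : Torus.IsRealCoeff (fourierRestrict (Torus.freqBall (d := Fin 3) N) f) :=
    Torus.isRealCoeff_mFourierCoeff hf.integrable
  obtain ⟨x, hx0, -, e, z, hlt, hEconv, hZconv, htails⟩ :=
    exists_good_datum hν hf hf0 hL hB hS hres hE₀ hε hE hD hL1 hthr
  obtain ⟨ha, ha0, hEn, hTr, hZ⟩ := orbit_dictionary (ν := ν) (f := f) x hx0
  -- the observables along the phase orbit, as real functions of time
  set En : ℝ → ℝ := fun t => ∑ k ∈ Torus.freqBall N, ‖Torus.coeffExt (Torus.freqBall N)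
    ((galerkinPhaseFlow ν (fourierRestrict (Torus.freqBall N) f) t x :
      ↥(galerkinSubspace (Torus.freqBall (d := Fin 3) N))) :
        ↥(Torus.freqBall (d := Fin 3) N) → EuclideanSpace ℂ (Fin 3)) k‖ ^ 2 with hEn_def
  set Bd : ℕ → ℝ → ℝ := fun Lv t => 4 * Real.pi ^ 2 * ∑ k ∈ Torus.freqBall Lv, Torus.freqNormSq k *
    ‖Torus.coeffExt (Torus.freqBall N) ((galerkinPhaseFlow ν (fourierRestrict (Torus.freqBall N) f) t x :
      ↥(galerkinSubspace (Torus.freqBall (d := Fin 3) N))) :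
        ↥(Torus.freqBall (d := Fin 3) N) → EuclideanSpace ℂ (Fin 3)) k‖ ^ 2 with hBd_def
  have hEn0 : ∀ t, 0 ≤ En t := fun t => Finset.sum_nonneg fun k _ => sq_nonneg _
  have hBd0 : ∀ Lv t, 0 ≤ Bd Lv t := fun Lv t =>
    mul_nonneg (by positivity) (Finset.sum_nonneg fun k _ => mul_nonneg (Torus.freqNormSq_nonneg k) (sq_nonneg _))
  have hBdle : ∀ Lv t, Bd Lv t ≤ Bd N t := fun Lv t => coeffBand_le_coeffBand Lv _
  have hBdN : ∀ t, Bd N t ≤ 4 * Real.pi ^ 2 * (N : ℝ) ^ 2 * En t := fun t => coeffBand_le_sq_mul _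
  have hZ' : ∀ t, Torus.eGradNormSq (Torus.galerkinFlow ν f N t
      (Torus.realTrigPoly (Torus.freqBall N) (Torus.coeffExt (Torus.freqBall N)
        (x : ↥(Torus.freqBall (d := Fin 3) N) → EuclideanSpace ℂ (Fin 3))))) = ENNReal.ofReal (Bd N t) := hZ
  have hTr' : ∀ (K : ℕ) (t : ℝ), Torus.eGradNormSq (Torus.fourierTruncate K (Torus.galerkinFlow ν f N t
      (Torus.realTrigPoly (Torus.freqBall N) (Torus.coeffExt (Torus.freqBall N)
        (x : ↥(Torus.freqBall (d := Fin 3) N) → EuclideanSpace ℂ (Fin 3)))))) = ENNReal.ofReal (Bd K t) := hTr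
  have hEn' : ∀ t, (∫ y, ‖Torus.galerkinFlow ν f N t (Torus.realTrigPoly (Torus.freqBall N) (Torus.coeffExt (Torus.freqBall N)
      (x : ↥(Torus.freqBall (d := Fin 3) N) → EuclideanSpace ℂ (Fin 3)))) y‖ ^ 2) = En t := hEn
  have hEni : ∀ a' b', 0 ≤ a' → 0 ≤ b' → IntervalIntegrable En volume a' b' := fun a' b' ha' hb' =>
    intervalIntegrable_obs hν.le hg continuous_coeffEnergy x ha' hb'
  have hBdi : ∀ Lv a' b', 0 ≤ a' → 0 ≤ b' → IntervalIntegrable (Bd Lv) volume a' b' := fun Lv a' b' ha' hb' =>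
    intervalIntegrable_obs hν.le hg (continuous_coeffBand Lv) x ha' hb'
  -- orbit quantities of the crux in terms of `En`, `Bd`
  have hnum : ∀ T, 0 ≤ T → (ν * (∫⁻ t in Ioo 0 T, Torus.eGradNormSq (Torus.galerkinFlow ν f N t
      (Torus.realTrigPoly (Torus.freqBall N) (Torus.coeffExt (Torus.freqBall N)
        (x : ↥(Torus.freqBall (d := Fin 3) N) → EuclideanSpace ℂ (Fin 3)))))).toReal) = ∫ t in (0 : ℝ)..T, ν * Bd N t := by
    intro T hT
    have hint : Integrable (Bd N) (volume.restrict (Ioo 0 T)) := ((hBdi N 0 T le_rfl hT).1).mono_set Ioo_subset_Ioc_self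
    simp_rw [hZ']
    rw [← ofReal_integral_eq_lintegral_ofReal hint (ae_of_all _ fun t => hBd0 N t),
      ENNReal.toReal_ofReal (integral_nonneg fun t => hBd0 N t), intervalIntegral.integral_const_mul,
      intervalIntegral.integral_of_le hT, integral_Ioc_eq_integral_Ioo]
  have hden : ∀ T, (∫ t in (0 : ℝ)..T, ∫ y, ‖Torus.galerkinFlow ν f N t
      (Torus.realTrigPoly (Torus.freqBall N) (Torus.coeffExt (Torus.freqBall N)
        (x : ↥(Torus.freqBall (d := Fin 3) N) → EuclideanSpace ℂ (Fin 3)))) y‖ ^ 2) = ∫ t in (0 : ℝ)..T, En t := by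
    intro T
    simp_rw [hEn']
  have htail : ∀ (K : ℕ) (T : ℝ), 0 ≤ T → (∫⁻ t in Ioo 0 T, (Torus.eGradNormSq (Torus.galerkinFlow ν f N t
      (Torus.realTrigPoly (Torus.freqBall N) (Torus.coeffExt (Torus.freqBall N)
        (x : ↥(Torus.freqBall (d := Fin 3) N) → EuclideanSpace ℂ (Fin 3))))) -
      Torus.eGradNormSq (Torus.fourierTruncate K (Torus.galerkinFlow ν f N t
        (Torus.realTrigPoly (Torus.freqBall N) (Torus.coeffExt (Torus.freqBall N)
          (x : ↥(Torus.freqBall (d := Fin 3) N) → EuclideanSpace ℂ (Fin 3)))))))) =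
        ENNReal.ofReal (∫ t in (0 : ℝ)..T, (Bd N t - Bd K t)) := by
    intro K T hT
    have hint : Integrable (fun t => Bd N t - Bd K t) (volume.restrict (Ioo 0 T)) :=
      (((hBdi N 0 T le_rfl hT).1).mono_set Ioo_subset_Ioc_self).sub (((hBdi K 0 T le_rfl hT).1).mono_set Ioo_subset_Ioc_self)
    have hpt : ∀ t, Torus.eGradNormSq (Torus.galerkinFlow ν f N t
        (Torus.realTrigPoly (Torus.freqBall N) (Torus.coeffExt (Torus.freqBall N)
          (x : ↥(Torus.freqBall (d := Fin 3) N) → EuclideanSpace ℂ (Fin 3))))) -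
        Torus.eGradNormSq (Torus.fourierTruncate K (Torus.galerkinFlow ν f N t
          (Torus.realTrigPoly (Torus.freqBall N) (Torus.coeffExt (Torus.freqBall N)
            (x : ↥(Torus.freqBall (d := Fin 3) N) → EuclideanSpace ℂ (Fin 3)))))) = ENNReal.ofReal (Bd N t - Bd K t) := by
      intro t
      rw [hZ' t, hTr' K t]
      exact (ENNReal.ofReal_sub _ (hBd0 K t)).symm
    simp_rw [hpt]
    rw [← ofReal_integral_eq_lintegral_ofReal hint (ae_of_all _ fun t => sub_nonneg.2 (hBdle K t)),
      intervalIntegral.integral_of_le hT, integral_Ioc_eq_integral_Ioo]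
  refine ⟨_, ha, ha0, ?_, fun n => ?_⟩
  · -- the Taylor ratio: `le_liminf_ratio` with `D = ν Bd N`, `E = En`
    have hκ₀ : 0 ≤ ε / (2 * E₀) := by positivity
    have hz' : Tendsto (fun n : ℕ => (n : ℝ)⁻¹ * ∫ t in (0 : ℝ)..(n : ℝ), ν * Bd N t) atTop (𝓝 (ν * z)) := by
      have h := hZconv.const_mul ν
      refine h.congr fun n => ?_
      simp only [hBd_def]
      rw [intervalIntegral.integral_const_mul ν]; ring
    have hlt' : ε / (2 * E₀) * e < ν * z := hlt
    have hmain := le_liminf_ratio (D := fun t => ν * Bd N t) (E := En) (fun t => mul_nonneg hν.le (hBd0 N t)) hEn0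
      (c := ν * (4 * Real.pi ^ 2 * (N : ℝ) ^ 2)) (by positivity)
      (fun t => by rw [mul_assoc]; exact mul_le_mul_of_nonneg_left (hBdN t) hν.le)
      (fun a' b' ha' hb' => (hBdi N a' b' ha' hb').const_mul ν) hEni hκ₀ hz' hEconv hlt'
    refine hmain.trans_eq (liminf_congr ?_)
    filter_upwards [eventually_ge_atTop (0 : ℝ)] with T hT
    rw [hnum T hT, hden T]
  · -- the tails: `limsup_ofReal_timeMean_le` with `G = Bd N − Bd (κ (ms n))`
    obtain ⟨τ, hτ, hτconv⟩ := htails n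
    set K : ℕ := κ ((n + 1) * 2 ^ (n + 1) * L) with hK
    have hG0 : ∀ t, 0 ≤ Bd N t - Bd K t := fun t => sub_nonneg.2 (hBdle K t)
    have hGi : ∀ a' b', 0 ≤ a' → 0 ≤ b' → IntervalIntegrable (fun t => Bd N t - Bd K t) volume a' b' :=
      fun a' b' ha' hb' => (hBdi N a' b' ha' hb').sub (hBdi K a' b' ha' hb')
    have hmain := limsup_ofReal_timeMean_le hG0 hGi hτconv
    have heq : (fun T : ℝ => (ENNReal.ofReal T)⁻¹ * ∫⁻ t in Ioo 0 T, (Torus.eGradNormSq (Torus.galerkinFlow ν f N t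
        (Torus.realTrigPoly (Torus.freqBall N) (Torus.coeffExt (Torus.freqBall N)
          (x : ↥(Torus.freqBall (d := Fin 3) N) → EuclideanSpace ℂ (Fin 3))))) -
        Torus.eGradNormSq (Torus.fourierTruncate K (Torus.galerkinFlow ν f N t
          (Torus.realTrigPoly (Torus.freqBall N) (Torus.coeffExt (Torus.freqBall N)
            (x : ↥(Torus.freqBall (d := Fin 3) N) → EuclideanSpace ℂ (Fin 3)))))))) =ᶠ[atTop]
        fun T : ℝ => ENNReal.ofReal (T⁻¹ * ∫ t in (0 : ℝ)..T, (Bd N t - Bd K t)) := by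
      filter_upwards [eventually_gt_atTop (0 : ℝ)] with T hT
      rw [htail K T hT.le, ← ENNReal.ofReal_inv_of_pos hT,
        ← ENNReal.ofReal_mul (inv_nonneg.2 hT.le)]
    rw [limsup_congr heq]
    refine hmain.trans ?_
    rw [inv_natCast_add_one_eq_ofReal]
    exact ENNReal.ofReal_le_ofReal hτ

/-- **`MomentLadder → T_res` (THE CONVERSE).** From a witness family of the crux: at each `j`, close over the moment order
(`stub_closureAllDegrees`), choose LEVEL-FREE thresholds from `(ν_j, ε, R_j, κ_j)` (`goodDatum_thresholds_exist`) — this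
is where `N`-uniformity of the re-indexed schedule comes from — and, for each of the infinitely many levels `N`, select one
good datum (`exists_datum_oneTrajectory`). The ratio `κ := ε / (2 max E 1)` is uniform in `j`. [folklore] -/
theorem oneTrajectoryResolved_of_MomentLadder : MomentLadder →
    ∃ f : UnitAddTorus (Fin 3) → EuclideanSpace ℝ (Fin 3),
      Torus.IsSmooth f ∧ Torus.IsDivFree f ∧ Torus.HasZeroMean f ∧ f ≠ 0 ∧
      ∃ (ν : ℕ → ℝ) (κ : ℝ), (∀ j, 0 < ν j) ∧ Tendsto ν atTop (𝓝 0) ∧ 0 < κ ∧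
        ∀ j : ℕ, ∃ K : ℕ → ℕ, ∃ᶠ N in atTop, ∃ a : UnitAddTorus (Fin 3) → EuclideanSpace ℝ (Fin 3),
          IsGalerkinMode N a ∧ Torus.HasZeroMean a ∧
          κ ≤ Filter.liminf (fun T : ℝ =>
            (ν j * (∫⁻ t in Ioo 0 T, Torus.eGradNormSq (Torus.galerkinFlow (ν j) f N t a)).toReal) /
              (∫ t in (0 : ℝ)..T, ∫ x, ‖Torus.galerkinFlow (ν j) f N t a x‖ ^ 2)) atTop ∧
          ∀ n : ℕ, Filter.limsup (fun T : ℝ => (ENNReal.ofReal T)⁻¹ *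
            ∫⁻ t in Ioo 0 T, (Torus.eGradNormSq (Torus.galerkinFlow (ν j) f N t a) -
              Torus.eGradNormSq (Torus.fourierTruncate (K n) (Torus.galerkinFlow (ν j) f N t a)))) atTop ≤
            ((n : ℝ≥0∞) + 1)⁻¹ := by
  intro h
  obtain ⟨f, hfs, hfd, hfz, ν, E, ε, hν, hν0, hε, hj⟩ := momentLadder_iff.1 h
  -- budgets uniform in `j`
  set E' : ℝ := max E 1 with hE'
  have hE'0 : 0 < E' := lt_of_lt_of_le zero_lt_one (le_max_right _ _)
  -- the force is not zero (any loud witness)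
  have hf0 : f ≠ 0 := by
    obtain ⟨R, κ, hfreq⟩ := hj 0
    obtain ⟨N, hN⟩ := hfreq.exists
    obtain ⟨μ, hμ⟩ := hN 3
    intro h0
    exact hμ.force_not_ae_zero (hfs.memLp 2) hε le_rfl (h0 ▸ EventuallyEq.rfl)
  refine ⟨f, hfs, hfd, hfz, hf0, ν, ε / (2 * E'), hν, hν0, by positivity, fun j => ?_⟩
  obtain ⟨R, κ, hfreq⟩ := hj j
  -- LEVEL-FREE thresholds, chosen before `N`
  obtain ⟨n₀, L, hL1, hthr⟩ := goodDatum_thresholds_exist (ν j) ε R κ (hν j) hε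
  refine ⟨fun n => κ ((n + 1) * 2 ^ (n + 1) * L), hfreq.mono fun N hN => ?_⟩
  -- close over the degree, then select
  obtain ⟨μ, hP, hlev, hsupp, hres, hstat, hEμ, hεμ⟩ := stub_closureAllDegrees f hfs (ν j) N E ε R κ hN
  haveI := hP
  obtain ⟨a, ha, ha0, hratio, htails⟩ := exists_datum_oneTrajectory (hν j) hfs hfz hlev hsupp hstat hres hE'0 hε
    (hEμ.trans (le_max_left _ _)) hεμ hL1 hthr
  exact ⟨a, ha, ha0, hratio, htails⟩

/-- **THE ONE-TRAJECTORY CURRENCY IS EXACT: `T_res ↔ MomentLadder`.** The crux `MomentParity.MomentLadder` holds iff for some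
smooth divergence-free mean-zero force `f ≠ 0`, viscosities `ν_j → 0⁺` and ONE ratio `κ > 0`, at every `j` some LEVEL-FREE
schedule `K_j` admits, for infinitely many Galerkin levels `N`, ONE mean-zero Galerkin datum whose orbit has cumulative
Taylor ratio `liminf_T ν_j∫₀ᵀ‖∇u‖² / ∫₀ᵀ|u|² ≥ κ` and resolved time-averaged enstrophy
`limsup_T T⁻¹∫₀ᵀ (‖∇u‖² − ‖∇P_{K_j n}u‖²) ≤ 1/(n+1)` for all `n` — one converged DNS run per `(ν_j, N)` (Kaneda et al. 2003),
uniformly resolved in the level. `→`: `MomentLadder_of_oneTrajectoryResolved` (Krylov–Bogoliubov with resolution rows);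
`←`: `oneTrajectoryResolved_of_MomentLadder` (Birkhoff selection with the UI budget of the resolution clause). [folklore] -/
theorem oneTrajectoryResolved_iff_MomentLadder :
    (∃ f : UnitAddTorus (Fin 3) → EuclideanSpace ℝ (Fin 3),
      Torus.IsSmooth f ∧ Torus.IsDivFree f ∧ Torus.HasZeroMean f ∧ f ≠ 0 ∧
      ∃ (ν : ℕ → ℝ) (κ : ℝ), (∀ j, 0 < ν j) ∧ Tendsto ν atTop (𝓝 0) ∧ 0 < κ ∧
        ∀ j : ℕ, ∃ K : ℕ → ℕ, ∃ᶠ N in atTop, ∃ a : UnitAddTorus (Fin 3) → EuclideanSpace ℝ (Fin 3),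
          IsGalerkinMode N a ∧ Torus.HasZeroMean a ∧
          κ ≤ Filter.liminf (fun T : ℝ =>
            (ν j * (∫⁻ t in Ioo 0 T, Torus.eGradNormSq (Torus.galerkinFlow (ν j) f N t a)).toReal) /
              (∫ t in (0 : ℝ)..T, ∫ x, ‖Torus.galerkinFlow (ν j) f N t a x‖ ^ 2)) atTop ∧
          ∀ n : ℕ, Filter.limsup (fun T : ℝ => (ENNReal.ofReal T)⁻¹ *
            ∫⁻ t in Ioo 0 T, (Torus.eGradNormSq (Torus.galerkinFlow (ν j) f N t a) -
              Torus.eGradNormSq (Torus.fourierTruncate (K n) (Torus.galerkinFlow (ν j) f N t a)))) atTop ≤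
            ((n : ℝ≥0∞) + 1)⁻¹) ↔ MomentLadder :=
  ⟨MomentLadder_of_oneTrajectoryResolved, oneTrajectoryResolved_of_MomentLadder⟩

/-- **The crux implies the sibling crux's open one-trajectory stub verbatim** (`stub_oneTrajectoryTaylor` of the line
`taylor-cone-homogenisation` of `GalerkinInvariantLoud`). [folklore] -/
theorem oneTrajectoryTaylor_of_MomentLadder : MomentLadder →
    ∃ f : UnitAddTorus (Fin 3) → EuclideanSpace ℝ (Fin 3),
      Torus.IsSmooth f ∧ Torus.IsDivFree f ∧ Torus.HasZeroMean f ∧ f ≠ 0 ∧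
      ∃ (ν : ℕ → ℝ) (κ : ℝ), (∀ j, 0 < ν j) ∧ Tendsto ν atTop (𝓝 0) ∧ 0 < κ ∧
        ∀ j : ℕ, ∃ᶠ N in atTop, ∃ a : UnitAddTorus (Fin 3) → EuclideanSpace ℝ (Fin 3),
          IsGalerkinMode N a ∧ Torus.HasZeroMean a ∧
          κ ≤ Filter.liminf (fun T : ℝ =>
            (ν j * (∫⁻ t in Ioo 0 T, Torus.eGradNormSq (Torus.galerkinFlow (ν j) f N t a)).toReal) /
              (∫ t in (0 : ℝ)..T, ∫ x, ‖Torus.galerkinFlow (ν j) f N t a x‖ ^ 2)) atTop := fun h =>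
  oneTrajectoryTaylor_of_oneTrajectoryResolved (oneTrajectoryResolved_of_MomentLadder h)

/-- A level-`N` law is trivially resolved by the constant schedule `κ ≡ N`. [folklore] -/
theorem isResolved_const_of_isLevel {N : ℕ} {μ : Measure H3} (hL : ∀ᵐ u ∂μ, IsLevel N u) :
    IsResolved (fun _ => N) μ := by
  intro n
  have h : ∫⁻ u, Torus.eGradNormSq (Torus.fourierTruncate N (u.1 : T3 → R3)) ∂μ =
      ∫⁻ u, Torus.eGradNormSq (u.1 : T3 → R3) ∂μ :=
    lintegral_congr_ae (hL.mono fun u hu => CubicParityLoud.Negative.eGradNormSq_fourierTruncate_of_isLevel hu)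
  rw [h]
  exact le_self_add

/-- **`GalerkinInvariantLoud → stub_oneTrajectoryTaylor` (the sibling line's currency loop closes).** Every witness family of
`MomentParity.GalerkinInvariantLoud` yields, per `(j, N)`, ONE mean-zero Galerkin datum with cumulative Taylor ratio
`≥ ε/(2 max E 1)`: Birkhoff selection with the trivial schedule `κ ≡ N` (no level-uniformity is asked by the stub). Together
with the landed S1–S3 of that line (`…StubEnergyFloor/TaylorReduction/KrylovBogoliubov`), the one-trajectory Taylor statement
is EQUIVALENT to `GalerkinInvariantLoud`. [folklore] -/
theorem oneTrajectoryTaylor_of_galerkinInvariantLoud : GalerkinInvariantLoud →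
    ∃ f : UnitAddTorus (Fin 3) → EuclideanSpace ℝ (Fin 3),
      Torus.IsSmooth f ∧ Torus.IsDivFree f ∧ Torus.HasZeroMean f ∧ f ≠ 0 ∧
      ∃ (ν : ℕ → ℝ) (κ : ℝ), (∀ j, 0 < ν j) ∧ Tendsto ν atTop (𝓝 0) ∧ 0 < κ ∧
        ∀ j : ℕ, ∃ᶠ N in atTop, ∃ a : UnitAddTorus (Fin 3) → EuclideanSpace ℝ (Fin 3),
          IsGalerkinMode N a ∧ Torus.HasZeroMean a ∧
          κ ≤ Filter.liminf (fun T : ℝ =>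
            (ν j * (∫⁻ t in Ioo 0 T, Torus.eGradNormSq (Torus.galerkinFlow (ν j) f N t a)).toReal) /
              (∫ t in (0 : ℝ)..T, ∫ x, ‖Torus.galerkinFlow (ν j) f N t a x‖ ^ 2)) atTop := by
  intro h
  obtain ⟨f, hfs, hfd, hfz, ν, E, ε, hν, hν0, hε, hj⟩ := h
  set E' : ℝ := max E 1 with hE'
  have hE'0 : 0 < E' := lt_of_lt_of_le zero_lt_one (le_max_right _ _)
  -- a loud invariant law is a ladder witness for the trivial schedule, so the force is not zero
  have hf0 : f ≠ 0 := by
    obtain ⟨R, hfreq⟩ := hj 0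
    obtain ⟨N, μ, hP, hlev, hsupp, hstat, hEμ, hεμ⟩ := hfreq.exists
    intro h0
    have hw : IsLadderWitness f (ν 0) N E ε R (fun _ => N) 3 μ :=
      ⟨hP, hlev, hsupp, @isResolved_const_of_isLevel N μ hlev, fun m g P hg _ => hstat m g P hg, hEμ, hεμ⟩
    exact hw.force_not_ae_zero (hfs.memLp 2) hε le_rfl (h0 ▸ EventuallyEq.rfl)
  refine ⟨f, hfs, hfd, hfz, hf0, ν, ε / (2 * E'), hν, hν0, by positivity, fun j => ?_⟩
  obtain ⟨R, hfreq⟩ := hj j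
  refine hfreq.mono fun N hN => ?_
  obtain ⟨μ, hP, hlev, hsupp, hstat, hEμ, hεμ⟩ := hN
  haveI := hP
  have hstat' : ∀ d : ℕ, IsPolyStationary (ν j) f N d μ := fun d m g P hg _ => hstat m g P hg
  have hres : IsResolved (fun _ => N) μ := isResolved_const_of_isLevel hlev
  obtain ⟨n₀, L, hL1, hthr⟩ := goodDatum_thresholds_exist (ν j) ε R (fun _ => N) (hν j) hε
  obtain ⟨a, ha, ha0, hratio, -⟩ := exists_datum_oneTrajectory (hν j) hfs hfz hlev hsupp hstat' hres hE'0 hε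
    (hEμ.trans (le_max_left _ _)) hεμ hL1 hthr
  exact ⟨a, ha, ha0, hratio⟩

end Assembly

end Summit.AnomalousDissipation.AnomalousDissipation.Theorems.MomentLadder

end
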